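import Mathlib
import Summits.Ventures.HodgeRepro2.T5CyclotomicSubfieldSatake

/-!
# THE RESIDUE DEGREE OF THE PLACE `v` OF `F⁺` AND `N(v)`, READ OFF `(ℤ/mℤ)ˣ / H_F` IN BOTH REGIMES

Tier-5 support N3 / §G-N4.2 (seat p3, gen 81). File 295 reads `f(v/p)` at a NON-SPLIT place of a CM subfield
`F ⊆ ℚ(ζₘ)`: `2 f(v/p) = ord(p · H_F)`. This file completes the dictionary with the split case:

* `inertiaDeg_over_eq_one_of_ncard_eq_two`: `f(𝔭/v) = 1` when two primes of `F` lie above `v` (`e f g = 2` with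
  `g = 2`, for every CM field);
* **`inertiaDeg_under_eq_orderOf_mk_of_notMem`**: at a split place, `f(v/p) = ord(p · H_F)`;
* **`inertiaDeg_under_eq`**: `f(v/p) = ord(p · H_F) / 2` if `(−1) · H_F ∈ ⟨p · H_F⟩`, `= ord(p · H_F)` otherwise;
  **`absNorm_eq`**: `N(v) = p^{f(v/p)}` accordingly — so `q = N(v)` of the record's local pair is a finite computation
  in `(ℤ/mℤ)ˣ` at every place of `F⁺` above `p ∤ m`, for every abelian CM field presented in a cyclotomic field.

§8(d): uses an L-value-free non-vanishing device: NO.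
-/

open NumberField NumberField.IsCMField IsCyclotomicExtension.Rat Ideal IsDedekindDomain
  IsDedekindDomain.HeightOneSpectrum
open Summit.Ventures.HodgeRepro2.T5CyclotomicSubfieldInertiaDeg
  Summit.Ventures.HodgeRepro2.T5CyclotomicSubfieldDecomposition
  Summit.Ventures.HodgeRepro2.T5CyclotomicSubfieldSatake

namespace Summit.Ventures.HodgeRepro2.T5CyclotomicSubfieldUnderDegree

section General

variable (K : Type*) [Field K] [NumberField K] [IsCMField K]
  (v : HeightOneSpectrum (𝓞 (maximalRealSubfield K)))
  (𝔭 : Ideal (𝓞 K)) [h𝔭 : 𝔭.IsPrime] [h𝔭v : 𝔭.LiesOver v.asIdeal]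

include h𝔭 h𝔭v in
/-- **`f(𝔭/v) = 1` at a split place** (`g = 2` in `e f g = 2`, file 125's `ncard_primesOver_mul_eq_two`). -/
theorem inertiaDeg_over_eq_one_of_ncard_eq_two (h2 : (v.asIdeal.primesOver (𝓞 K)).ncard = 2) :
    𝔭.inertiaDeg (𝓞 (maximalRealSubfield K)) = 1 := by
  have h := T5FinitePlaceLocalDegree.ncard_primesOver_mul_eq_two K v
  rw [h2] at h
  have h1 : v.asIdeal.ramificationIdxIn (𝓞 K) * v.asIdeal.inertiaDegIn (𝓞 K) = 1 := by omega
  haveI : IsGaloisGroup (K ≃ₐ[maximalRealSubfield K] K) (𝓞 (maximalRealSubfield K)) (𝓞 K) :=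
    IsGaloisGroup.of_isFractionRing _ _ _ (maximalRealSubfield K) K
  rw [inertiaDegIn_eq_inertiaDeg v.asIdeal 𝔭 (K ≃ₐ[maximalRealSubfield K] K)] at h1
  exact Nat.eq_one_of_mul_eq_one_left h1

end General

section Cyclotomic

variable (m : ℕ) [NeZero m] (L : Type*) [Field L] [NumberField L] [IsCyclotomicExtension {m} ℚ L] [IsCMField L]
  (F : IntermediateField ℚ L) [IsCMField F]
variable (p : ℕ) [hp : Fact p.Prime] (hpm : p.Coprime m)
  (𝔭 : Ideal (𝓞 F)) [h𝔭 : 𝔭.IsPrime] [h𝔭p : 𝔭.LiesOver (span {(p : ℤ)})]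
  (v : HeightOneSpectrum (𝓞 (maximalRealSubfield F))) [hPv : 𝔭.LiesOver v.asIdeal]

include hpm h𝔭 h𝔭p hPv in
/-- **At a split place `f(v/p) = ord(p · H_F)`** (`f(𝔭/p) = f(v/p) · f(𝔭/v)` with `f(𝔭/v) = 1`). -/
theorem inertiaDeg_under_eq_orderOf_mk_of_notMem
    (hnot : (QuotientGroup.mk (-1) : (ZMod m)ˣ ⧸ zmodSubgroup m L F) ∉
      Subgroup.zpowers (QuotientGroup.mk (ZMod.unitOfCoprime p hpm))) :
    v.asIdeal.inertiaDeg ℤ =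
      orderOf (QuotientGroup.mk (ZMod.unitOfCoprime p hpm) : (ZMod m)ˣ ⧸ zmodSubgroup m L F) := by
  have h2 := (ncard_primesOver_eq_two_iff_notMem m L F p hpm 𝔭 v).mpr hnot
  have hf1 := inertiaDeg_over_eq_one_of_ncard_eq_two F v 𝔭 h2
  have htower : 𝔭.inertiaDeg ℤ = v.asIdeal.inertiaDeg ℤ * 𝔭.inertiaDeg (𝓞 (maximalRealSubfield F)) :=
    Ideal.inertiaDeg_tower (R := ℤ) v.asIdeal 𝔭
  rw [hf1, mul_one] at htower
  rw [← htower, inertiaDeg_eq_orderOf_mk m L F p hpm 𝔭]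

include hpm h𝔭 h𝔭p hPv in
/-- **`f(v/p)` IN BOTH REGIMES**: `ord(p · H_F) / 2` if `(−1) · H_F ∈ ⟨p · H_F⟩` (the place stays prime), `ord(p · H_F)`
otherwise (it splits). -/
theorem inertiaDeg_under_eq :
    v.asIdeal.inertiaDeg ℤ =
      if (QuotientGroup.mk (-1) : (ZMod m)ˣ ⧸ zmodSubgroup m L F) ∈
          Subgroup.zpowers (QuotientGroup.mk (ZMod.unitOfCoprime p hpm)) then
        orderOf (QuotientGroup.mk (ZMod.unitOfCoprime p hpm) : (ZMod m)ˣ ⧸ zmodSubgroup m L F) / 2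
      else orderOf (QuotientGroup.mk (ZMod.unitOfCoprime p hpm) : (ZMod m)ˣ ⧸ zmodSubgroup m L F) := by
  split_ifs with hmem
  · exact inertiaDeg_under_eq_orderOf_mk_div_two m L F p hpm 𝔭 v hmem
  · exact inertiaDeg_under_eq_orderOf_mk_of_notMem m L F p hpm 𝔭 v hmem

include hpm h𝔭 h𝔭p hPv in
/-- **`N(v) = p^{f(v/p)}` read off `(ℤ/mℤ)ˣ / H_F`**: the `q` of the record's local pair at `v`. -/
theorem absNorm_eq :
    Ideal.absNorm v.asIdeal =
      p ^ (if (QuotientGroup.mk (-1) : (ZMod m)ˣ ⧸ zmodSubgroup m L F) ∈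
            Subgroup.zpowers (QuotientGroup.mk (ZMod.unitOfCoprime p hpm)) then
          orderOf (QuotientGroup.mk (ZMod.unitOfCoprime p hpm) : (ZMod m)ˣ ⧸ zmodSubgroup m L F) / 2
        else orderOf (QuotientGroup.mk (ZMod.unitOfCoprime p hpm) : (ZMod m)ˣ ⧸ zmodSubgroup m L F)) := by
  haveI : v.asIdeal.LiesOver (span {(p : ℤ)}) := Ideal.LiesOver.tower_bot 𝔭 v.asIdeal _
  rw [T5SexticRecordSatake.absNorm_eq_pow_inertiaDeg F p v, inertiaDeg_under_eq m L F p hpm 𝔭 v]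

end Cyclotomic

end Summit.Ventures.HodgeRepro2.T5CyclotomicSubfieldUnderDegree
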